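import Literature.NumberTheory.GaloisRepresentations.TateH2VanishingCorestriction
import HarnessLib

/-!
# Locally constant torsion `2`-cocycles `G × G → ℚ/ℤ` and their classes in `H²(G, ℤ/N)`
# (bookkeeping for Tate's theorem `H²(G_K, ℚ/ℤ) = 0`)

Sibling proof file of `TateProjectiveLifting.lean` (theorems only).  The cochain statements of
`TateH2VanishingReduction.lean` concern locally constant `2`-cocycles `g : G × G → ℚ/ℤ` killed by
`N`; the tree's Galois cohomology (`galoisCohomology`, `galoisCohomology.localization`,
`DiscreteGaloisModule.shaTwo`, the Poitou–Tate facts) concerns classes in Mathlib's continuous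
cohomology `H²(G, ℤ/N)` of the trivial discrete module `ℤ/N = ZMod N`.  This file is the
dictionary (already used inside `twoCocycle_addCircle_prime_split_of_subgroup_coprime`):

* `exists_contTwoCocycles_zmod_of_addCircle` — an `N`-torsion locally constant cocycle `g` is
  `e ∘ γ` for a continuous `ℤ/N`-valued `2`-cocycle `γ` of the trivial module, for any embedding
  `e : ℤ/N ↪ ℚ/ℤ` onto the `N`-torsion (`zmod_exists_addMonoidHom_addCircle`);
* `map_twoCocycleClass_trivial_eq_zero_iff` — **for a continuous homomorphism `θ : H → G`, the
  pull-back `θ^*[γ] ∈ H²(H, ℤ/N)` (Mathlib `ContinuousCohomology.map θ (id)`, the map underlying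
  the tree's `galoisCohomology.pullback` / `res` / `localization`) vanishes iff `g ∘ (θ × θ)` is
  the coboundary of a locally constant `N`-torsion cochain on `H`**;
  `twoCocycleClass_trivial_eq_zero_iff` — the case `θ = id`.

## References

* J.-P. Serre, *Galois Cohomology* (1997), I §2.2–2.4 (functoriality of continuous cochain
  cohomology). [`SerreGaloisCohomology1997`]
-/

noncomputable section

open CategoryTheory Function

namespace Literature.NumberTheory.GaloisRepresentations

open _root_.TopRep _root_.ContRepresentation _root_.ContinuousCohomology

section Dictionary

variable {G : Type} [Group G] [TopologicalSpace G] [IsTopologicalGroup G]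
variable {H : Type} [Group H] [TopologicalSpace H] [IsTopologicalGroup H]

omit [IsTopologicalGroup G] in
/-- An `N`-torsion locally constant `2`-cocycle `g : G × G → ℚ/ℤ` is `e ∘ γ` for a continuous
`ℤ/N`-valued `2`-cocycle `γ` of the trivial module `ℤ/N`, `e : ℤ/N ↪ ℚ/ℤ` any embedding onto the
`N`-torsion. [folklore] -/
theorem exists_contTwoCocycles_zmod_of_addCircle {N : ℕ} (e : ZMod N →+ AddCircle (1 : ℚ))
    (he : Injective e) (hsurj : ∀ x : AddCircle (1 : ℚ), N • x = 0 → ∃ k : ZMod N, e k = x)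
    (g : G → G → AddCircle (1 : ℚ)) (hg : IsLocallyConstant (Function.uncurry g))
    (hcoc : ∀ σ τ υ, g σ τ + g (σ * τ) υ = g τ υ + g σ (τ * υ)) (hNg : ∀ σ τ, N • g σ τ = 0) :
    ∃ γ : contTwoCocycles (ContinuousRep.trivial G ℤ (ZMod N)).toTopRep,
      ∀ σ τ, e (γ.1 (σ, τ)) = g σ τ := by
  classical
  have hpre : ∀ x : AddCircle (1 : ℚ), ∃ k : ZMod N, N • x = 0 → e k = x := fun x => by
    by_cases hx : N • x = 0
    · obtain ⟨k, hk⟩ := hsurj x hx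
      exact ⟨k, fun _ => hk⟩
    · exact ⟨0, fun h => absurd h hx⟩
  choose ψ hψ using hpre
  let gN : C(G × G, ZMod N) := ⟨ψ ∘ Function.uncurry g, (hg.comp ψ).continuous⟩
  have hgNe : ∀ σ τ, e (gN (σ, τ)) = g σ τ := fun σ τ => hψ _ (hNg σ τ)
  have hgN_mem : gN ∈ contTwoCocycles (ContinuousRep.trivial G ℤ (ZMod N)).toTopRep := by
    rw [mem_contTwoCocycles_iff]
    intro σ τ υ
    change gN (τ, υ) + gN (σ, τ * υ) = gN (σ * τ, υ) + gN (σ, τ)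
    apply he
    rw [map_add, map_add, hgNe, hgNe, hgNe, hgNe, add_comm (g (σ * τ) υ), hcoc]
  exact ⟨⟨gN, hgN_mem⟩, hgNe⟩

variable [LocallyCompactSpace G] [LocallyCompactSpace H]

/-- **Pull-backs of the class of a torsion cocycle vanish iff the pulled-back cocycle splits by a
torsion cochain.**  Let `γ` be a continuous `ℤ/N`-valued `2`-cocycle of the trivial `G`-module
`ℤ/N`, `g = e ∘ γ` the corresponding `ℚ/ℤ`-valued cocycle (`e : ℤ/N ↪ ℚ/ℤ` onto the
`N`-torsion), and `θ : H →ₜ* G`.  Then `θ^*[γ] = 0` in `H²(H, ℤ/N)` (Mathlib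
`ContinuousCohomology.map θ` with the identity on coefficients — the map underlying
`galoisCohomology.pullback`, `res`, `localization`) iff `g ∘ (θ × θ) = ∂β` for a locally constant
`β : H → ℚ/ℤ` with `N β = 0`. [cite: SerreGaloisCohomology1997, I §2.2–2.4] -/
theorem map_twoCocycleClass_trivial_eq_zero_iff {N : ℕ} (e : ZMod N →+ AddCircle (1 : ℚ))
    (he : Injective e) (hsurj : ∀ x : AddCircle (1 : ℚ), N • x = 0 → ∃ k : ZMod N, e k = x)
    (γ : contTwoCocycles (ContinuousRep.trivial G ℤ (ZMod N)).toTopRep) (θ : H →ₜ* G) :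
    ContinuousCohomology.map θ (X := (ContinuousRep.trivial G ℤ (ZMod N)).toTopRep)
        (Y := ((ContinuousRep.trivial G ℤ (ZMod N)).restrict θ).toTopRep)
        (TopRep.ofHom ⟨ContinuousLinearMap.id ℤ (ZMod N), fun _ => rfl⟩) 2
        (twoCocycleClass _ γ) = 0 ↔
      ∃ β : H → AddCircle (1 : ℚ), IsLocallyConstant β ∧ (∀ h, N • β h = 0) ∧
        ∀ σ τ, e (γ.1 (θ σ, θ τ)) = β σ + β τ - β (σ * τ) := by
  classical
  rw [map_twoCocycleClass, twoCocycleClass_eq_zero_iff]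
  constructor
  · rintro ⟨b, hb⟩
    have hb_lc : IsLocallyConstant (b : H → ZMod N) :=
      (IsLocallyConstant.iff_continuous _).2 b.continuous
    refine ⟨e ∘ b, hb_lc.comp e, fun h => ?_, fun σ τ => ?_⟩
    · change N • e (b h) = 0
      rw [← map_nsmul, nsmul_eq_mul, ZMod.natCast_self, zero_mul, map_zero]
    · have h := hb σ τ
      rw [contTwoCocycles.pullback_apply] at h
      change γ.1 (θ σ, θ τ) = b τ - b (σ * τ) + b σ at h
      rw [h, map_add, map_sub]
      simp only [Function.comp_apply]
      abel
  · rintro ⟨β, hβ_lc, hβN, hβ⟩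
    have hpre : ∀ x : AddCircle (1 : ℚ), ∃ k : ZMod N, N • x = 0 → e k = x := fun x => by
      by_cases hx : N • x = 0
      · obtain ⟨k, hk⟩ := hsurj x hx
        exact ⟨k, fun _ => hk⟩
      · exact ⟨0, fun h => absurd h hx⟩
    choose ψ hψ using hpre
    refine ⟨⟨ψ ∘ β, (hβ_lc.comp ψ).continuous⟩, fun σ τ => ?_⟩
    rw [contTwoCocycles.pullback_apply]
    change γ.1 (θ σ, θ τ) = ψ (β τ) - ψ (β (σ * τ)) + ψ (β σ)
    apply he
    rw [hβ, map_add, map_sub, hψ _ (hβN _), hψ _ (hβN _), hψ _ (hβN _)]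
    abel

/-- The case `θ = id` of `map_twoCocycleClass_trivial_eq_zero_iff`: `[γ] = 0` in `H²(G, ℤ/N)` iff
`g = e ∘ γ` is the coboundary of a locally constant `N`-torsion cochain.
[cite: SerreGaloisCohomology1997, I §2.2] -/
theorem twoCocycleClass_trivial_eq_zero_iff {N : ℕ} (e : ZMod N →+ AddCircle (1 : ℚ))
    (he : Injective e) (hsurj : ∀ x : AddCircle (1 : ℚ), N • x = 0 → ∃ k : ZMod N, e k = x)
    (γ : contTwoCocycles (ContinuousRep.trivial G ℤ (ZMod N)).toTopRep) :
    twoCocycleClass _ γ = 0 ↔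
      ∃ β : G → AddCircle (1 : ℚ), IsLocallyConstant β ∧ (∀ h, N • β h = 0) ∧
        ∀ σ τ, e (γ.1 (σ, τ)) = β σ + β τ - β (σ * τ) := by
  classical
  rw [twoCocycleClass_eq_zero_iff]
  constructor
  · rintro ⟨b, hb⟩
    have hb_lc : IsLocallyConstant (b : G → ZMod N) :=
      (IsLocallyConstant.iff_continuous _).2 b.continuous
    refine ⟨e ∘ b, hb_lc.comp e, fun h => ?_, fun σ τ => ?_⟩
    · change N • e (b h) = 0
      rw [← map_nsmul, nsmul_eq_mul, ZMod.natCast_self, zero_mul, map_zero]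
    · have h := hb σ τ
      change γ.1 (σ, τ) = b τ - b (σ * τ) + b σ at h
      rw [h, map_add, map_sub]
      simp only [Function.comp_apply]
      abel
  · rintro ⟨β, hβ_lc, hβN, hβ⟩
    have hpre : ∀ x : AddCircle (1 : ℚ), ∃ k : ZMod N, N • x = 0 → e k = x := fun x => by
      by_cases hx : N • x = 0
      · obtain ⟨k, hk⟩ := hsurj x hx
        exact ⟨k, fun _ => hk⟩
      · exact ⟨0, fun h => absurd h hx⟩
    choose ψ hψ using hpre
    refine ⟨⟨ψ ∘ β, (hβ_lc.comp ψ).continuous⟩, fun σ τ => ?_⟩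
    change γ.1 (σ, τ) = ψ (β τ) - ψ (β (σ * τ)) + ψ (β σ)
    apply he
    rw [hβ, map_add, map_sub, hψ _ (hβN _), hψ _ (hβN _), hψ _ (hβN _)]
    abel

end Dictionary

end Literature.NumberTheory.GaloisRepresentations

end
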